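import Summits.SmoothPoincare4.SmoothPoincare4.Theses.EntropyRung
import Summits.SmoothPoincare4.SmoothPoincare4.Theorems.EntropyRungCompactShrinkerGapScalarIdentities
import Summits.SmoothPoincare4.SmoothPoincare4.Theorems.EntropyRungCompactShrinkerGapSigmaTwo
import Summits.SmoothPoincare4.SmoothPoincare4.Theorems.EntropyRungCompactShrinkerGapJensenVolumeBound
import Summits.SmoothPoincare4.SmoothPoincare4.Theorems.EntropyRungCompactShrinkerGapScalarCurvaturePos
import Summits.SmoothPoincare4.SmoothPoincare4.Theorems.EntropyRungCompactShrinkerGapVarianceBudgetEinstein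
import Summits.SmoothPoincare4.SmoothPoincare4.Theorems.EntropyRungCompactShrinkerGapVarianceBudgetScalarLe
import Summits.SmoothPoincare4.SmoothPoincare4.Theorems.EntropyRungCompactShrinkerGapNormSqHessian
import Summits.SmoothPoincare4.SmoothPoincare4.Theorems.EntropyRungCompactShrinkerGapHessianEnergy
import Summits.SmoothPoincare4.SmoothPoincare4.Theorems.EntropyRungCompactShrinkerGapWeightedDirichlet
import Summits.SmoothPoincare4.SmoothPoincare4.Theorems.EntropyRungCompactShrinkerGapWeightedHessianEnergy
import Summits.SmoothPoincare4.SmoothPoincare4.Theorems.EntropyRungCompactShrinkerGapVarianceGradSq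
import Literature.Geometry.Lorentzian.MetricNormSq
import Literature.Geometry.Riemannian.GradientShrinkerProofs
import Literature.Geometry.Riemannian.ChernGaussBonnetFour
import Literature.Geometry.Riemannian.ChangGurskyYangEuler
import Literature.Geometry.Riemannian.ChangGurskyYangRegularity
import Literature.Topology.FourManifolds.HomotopyS4SimplyConnected
import Literature.Topology.FourManifolds.SphereSimplyConnected
import HarnessLib
import HarnessLib.Audit

/-!
# Line `cgy-variance-pivot` for crux `EntropyRung.CompactShrinkerGap` (stmt-SmoothPoincare4-10870)

LEAD'S SKELETON v8 (fourth lead, prover-line-stmt-SmoothPoincare4-10870-3, 2026-08-16; v1/v2 first lead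
…-10870-0, v3–v5 second lead …-10870-1, v6/v7 third lead …-10870-2).

v8 RESHAPE — THE CHENG–RIBEIRO–ZHOU BOUND BECOMES A STUB (no coarea). The CRZ sub-line of v1–v7 carried
the UNFORMALISED named hypothesis `CRZSharpBound` (`D ≤ ½(e^{c}Z − V)` for every `c ≥ sup f`; sized L–XL
by leads 0–2 after the printed proof: coarea over sublevel sets + null level sets, CRZ Lemma 4). It is in
fact one integration by parts over the landed bookkeeping: for EVERY real `c`,
`D = ∫(R − 2|Ric|²)(e^{c−f} − 1) dV` — `e^{c}` times the weighted Green identity `∫(Δ_f R) e^{-f} dV = 0`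
(the input of p74723) minus the unweighted one `∫ Δ_f R dV = −∫g⁻¹(dR,df) = ∫RΔf = −D` (the input of
p71672/p74473), with `Δ_f R = R − 2|Ric|²` by (B) — and the pointwise trace Cauchy–Schwarz
`R² ≤ 4|Ric|²` (a `g`-orthonormal frame, the technique of p74355) gives `R − 2|Ric|² ≤ ½R(2 − R) ≤ ½`,
whence for `f ≤ c` the SIGN-KEPT form `D ≤ ½∫R(2 − R)(e^{c−f} − 1) dV` (Disproof §13's "sharper paper
form", loss 1.20 on Koiso–Cao) and the crude form `D ≤ ½(e^{c}Z − V)` (loss 3.37). New registered stubs: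
STUB 13 `stub_scalarCurvature_sq_le` (trace bound, pointwise), STUB 15 `stub_variance_eq_integral_defect`
(the identity, any `c`), STUB 14 `stub_crzSharpBound_of_identities`, STUB 16 `stub_crzSignKept_of_identities`
(both from 13 + 15 as hypotheses), and STUB 7 `stub_potentialLeThree` (`f ≤ 3`, OPEN, re-registered: with
13–16 landed it is the ONLY hypothesis left in `CompactShrinkerGap_of_crz (hCGY) (hCGB)`). The crux's open
content is thereby typed in three registered strengths: `stub_weylBudget` ⟸[CGB] `stub_varianceBudget`
⟸[CRZ, kernel-checked] `stub_potentialLeThree`.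

v7 RESHAPE (kept) — CHERN–GAUSS–BONNET LEAVES THE CLOSING PATH. Chang–Gursky–Yang Thm A (route crux
`EntropyRung.ChangGurskyYang`, stmt-10834, the hypothesis `hCGY`) consumes `R > 0`, `π₁ = 1` and the WEYL budget
`∫|W|² dV < 32π²` — nothing else. `R > 0` is LANDED (p71988 from p71473) and `π₁(M ≃ₕ S⁴) = 1` is PROVED in the
tree, so the crux follows from the Weyl budget ALONE: the new registered transfer target is
`stub_weylBudget` (crux data ⇒ `g.weylEnergy < 32π²`), and `CompactShrinkerGap_of (hCGY)` is now kernel-checked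
modulo that ONE stub — no Chern–Gauss–Bonnet, no second named fact. The variance form `stub_varianceBudget`
(`∫(R−2)² dV < 2V − 96π²`, the v1–v6 target, four drefute generations: 0 stub-false / 0 stub-misstated) stays
registered as the EQUIVALENT scalar form: `weylBudget_iff_varianceBudget` proves
`∫|W|² < 32π² ⟺ D < 2V − 96π²` for the crux data from the CGB formula taken as an explicit named-fact
HYPOTHESIS `(hCGB : Literature.Geometry.Riemannian.chernGaussBonnet_four)` (p72262) + the landed `∫σ₂ = V/6 − D/12`
(p71672) + `χ = 2`; every alternative composition below (Einstein, `R ≤ 2.48`, Hessian energy, weighted variance,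
Dirichlet energy, CRZ) therefore carries `hCGB` next to `hCGY`. So: whoever proves the Weyl budget closes the crux
with `hCGY` only; whoever proves the variance budget closes it with `hCGY` + the CGB fact. For the planner this
means ONE new route item (`WeylBudget`, text = the signature of `stub_weylBudget`, cone-clean: `g.weylEnergy` is
already route vocabulary via `ChangGurskyYang`) instead of two (`VarianceBudget` + `ChernGaussBonnetFour`).

The crux: a closed smooth `M ≃ₕ S⁴` carrying a normalised gradient shrinker
`Ric + Hess f = g/2`, `R + |∇f|² = f`, of Gaussian mass `Z = ∫ e^{-f} dV > Z₀ = 32π²√π e^{-3/2}`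
(density `Θ > Θ(S³×ℝ)`) is diffeomorphic to `S⁴`.

THE LINE. Spend the density on Chang–Gursky–Yang, not on Einstein rigidity: CGY Thm A (`R > 0`,
`∫|W|² < 32π² = 16π²χ`, `π₁ = 1`) returns `M ≅ S⁴`; `R > 0` holds on every closed shrinker; so the crux
IS the Weyl budget for dense shrinkers on homotopy 4-spheres (STUB W). In soliton scalars (`V = Vol`,
`D = ∫(R − 2)² dV`): `∫σ₂(A) dV = V/6 − D/12` (landed) and CGB with `χ = 2` give
`∫|W|² = 64π² − ⅔V + D/3`, so STUB W ⟺ `D < 2V − 96π²` (STUB 1) ⟺ `∫|Hess f|² dV < V − 48π²`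
(p74473) ⟺ `∫(1 − |Hess f|²) dV > 48π²` — true with margin `96π²` at the round shrinker `S⁴(√6)`.

WHAT IS LANDED (all under `Theorems/`, kernel-checked, std axioms): p71473 `stub_shrinkerScalarIdentities`
(`dR = 2Ric(♯df,·)`, (B) `ΔR = g⁻¹(dR,df) + R − 2|Ric|²`) · p71672 `stub_sigmaTwo_of_identities` · p71988
`stub_scalarCurvaturePos_of_identities` · p71839 `stub_jensenVolumeBound` (`Z ≤ e^{-2}V`, `V > 32π²√π e^{1/2}`)
· p72766 `stub_varianceBudget_of_einstein` · p73066 `stub_varianceBudget_of_scalarCurvature_le` (`R ≤ 2.48`)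
· p74355 `stub_normSqHessian` · p74473 `stub_hessianEnergy_of_identities` · p74633 `stub_weightedDirichlet`
· p74723 `stub_weightedHessianEnergy_of_identities` · p75235 `stub_variance_eq_gradSq_mul`; the CGB formula is
the NAMED FACT `Literature.Geometry.Riemannian.chernGaussBonnet_four` (def, p72262, undischarged).

REGISTERED STUBS (v8, 7): `stub_weylBudget` (OPEN transfer target, on the closing path) · `stub_varianceBudget`
(OPEN, the same target in soliton scalars; off the closing path, ⟺ STUB W modulo CGB) · `stub_potentialLeThree`
(OPEN, `f ≤ 3`, the CRZ sub-line's target) · `stub_scalarCurvature_sq_le` (S) · `stub_variance_eq_integral_defect`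
(M) · `stub_crzSharpBound_of_identities` (S/M) · `stub_crzSignKept_of_identities` (S/M). STUBS 8–12 are theorem
ALIASES of the landed decls. `CompactShrinkerGap_of : ChangGurskyYang → CompactShrinkerGap` is the composition.

DISPROOF USED (`Cruxes/CompactShrinkerGap/Disproof.lean` v8, read 2026-08-16T02:2xZ): §0 SPC4 sandwich;
§3 closedness load-bearing (every stub keeps `[CompactSpace M]`); §6 Jensen floor = landed
`volume_floor_of_density`; §11 CRZ sub-line ceiling `f ≤ 3.0807` (p71615), false without closedness
(p71580); §12 any proof must spend the density; §13 typed audit incl. `weylEnergy` = (0,4)-norm and the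
CGB/CGY normalisations (STUB W is CGY's hypothesis verbatim, so no new normalisation enters); §14 the
scalar toolkit admits violators (p74849) — STUB W/1 need a sup bound `f_max ≤ 3.08` from density or
tensorial structure; §15 density pinning; drefute g1–g4: 0 stub-false, 0 stub-misstated.
-/

noncomputable section

open MeasureTheory Set
open scoped Manifold ContDiff ENNReal Topology ContinuousMap MeasureTheory

namespace Summit.SmoothPoincare4.SmoothPoincare4.Cruxes.CompactShrinkerGap.CgyVariancePivot

set_option linter.unusedVariables false
set_option linter.dupNamespace false

open Summit.SmoothPoincare4.SmoothPoincare4.Theses.EntropyRung (CompactShrinkerGap ChangGurskyYang)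
open Summit.SmoothPoincare4.SmoothPoincare4
open Bundle Function Filter Module
open Literature.Geometry Literature.Geometry.Lorentzian Literature.Geometry.Riemannian
  Literature.Geometry.Lorentzian.PseudoRiemannianMetric

/-! ## The registered stubs -/

/-- **STUB W — TRANSFER TARGET (the Weyl budget; OPEN, hardest, held by the lead; v7).** For the
crux data (closed `M ≃ₕ S⁴`, Riemannian `g` with Levi-Civita connection, smooth `f`,
`Ric + Hess f = g/2`, `R + |∇f|² = f`, `∫ e^{-f} dV > 32π²√π e^{-3/2}`) the Weyl energy obeys
`∫|W|² dV < 32π²` (`g.weylEnergy`, the (0,4)-norm `W_{ijkl}W^{ijkl}` of `WeylEnergy.lean`; `32π² = 16π²χ`).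
This is EXACTLY the curvature hypothesis of Chang–Gursky–Yang Thm A for `M` (`R > 0` being automatic on
a closed shrinker), so the crux follows from it and `hCGY` with nothing else (`CompactShrinkerGap_of`).
Equivalent, given the Chern–Gauss–Bonnet formula (`χ = 2`) and the landed `∫σ₂ = V/6 − D/12`, to the
variance budget `∫(R − 2)² dV < 2V − 96π²` (STUB 1; `weylBudget_iff_varianceBudget`). True with margin at
the round shrinker `S⁴(√6)` (`W = 0`); conformally invariant; falsifiable by a dense non-round shrinker
on the STANDARD `S⁴` (none known: Kotschwar 2008, Donovan 2025 Conj. 1.5, Buttsworth 2022).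
[cite: ChangGurskyYang2003, Thm. A] [cite: CaoHamiltonIlmanen2004, §4] -/
theorem stub_weylBudget :
    ∀ (M : Type) [TopologicalSpace M] [T2Space M] [SecondCountableTopology M]
      [ChartedSpace (EuclideanSpace ℝ (Fin 4)) M] [IsManifold (𝓡 4) ∞ M] [CompactSpace M]
      [T3Space M] [MeasurableSpace M] [BorelSpace M],
      M ≃ₕ Metric.sphere (0 : EuclideanSpace ℝ (Fin 5)) 1 →
    ∀ (g : Literature.Geometry.Lorentzian.PseudoRiemannianMetric (𝓡 4) ∞ (EuclideanSpace ℝ (Fin 4))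
        (TangentSpace (𝓡 4) : M → Type _)) [g.HasLeviCivita] (f : M → ℝ) (hg : g.IsRiemannian),
      ContMDiff (𝓡 4) 𝓘(ℝ, ℝ) ∞ f →
      (∀ (x : M) (X Y : TangentSpace (𝓡 4) x),
        g.ricci x X Y + g.hessian f x X Y = (1 / 2 : ℝ) * g.val x X Y) →
      (∀ x : M, g.scalarCurvature x + g.gradSq f x = f x) →
      ENNReal.ofReal (32 * Real.pi ^ 2 * Real.sqrt Real.pi * Real.exp (-(3 : ℝ) / 2)) <
        ∫⁻ x, ENNReal.ofReal (Real.exp (-f x))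
          ∂(Literature.Geometry.Lorentzian.riemannianMeasure (g.toContMDiffRiemannianMetric hg)) →
      g.weylEnergy < ENNReal.ofReal (32 * Real.pi ^ 2) := by
  sorry

/-- **STUB 1 — the same target in soliton scalars (the variance budget; OPEN; ⟺ STUB W modulo CGB).** For
the crux data (closed `M ≃ₕ S⁴`, Riemannian `g` with Levi-Civita connection, smooth `f`,
`Ric + Hess f = g/2`, `R + |∇f|² = f`, `∫ e^{-f} dV > 32π²√π e^{-3/2}`) the unweighted variance of
the scalar curvature obeys `∫ (R − 2)² dV < 2·Vol(M,g) − 96π²`. Equivalent (given CGB, χ = 2,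
`stub_sigmaTwo_of_identities`) to the Chang–Gursky–Yang Weyl budget `∫|W|² dV < 32π²`, and (by
`stub_hessianEnergy_of_identities`) to `∫|Hess f|² dV < Vol − 48π²`; true with margin `96π²` at the
round shrinker `S⁴(√6)` (`D = 0`, `V = 96π²`), automatic in the Einstein sub-case and under
`R ≤ 2.48`; falsifiable by a dense non-round shrinker on the STANDARD `S⁴` (none known).
[cite: ChangGurskyYang2003, Thm. A] [cite: ChengRibeiroZhou2022, Thm. 1 and §3.2] -/
theorem stub_varianceBudget :
    ∀ (M : Type) [TopologicalSpace M] [T2Space M] [SecondCountableTopology M]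
      [ChartedSpace (EuclideanSpace ℝ (Fin 4)) M] [IsManifold (𝓡 4) ∞ M] [CompactSpace M]
      [T3Space M] [MeasurableSpace M] [BorelSpace M],
      M ≃ₕ Metric.sphere (0 : EuclideanSpace ℝ (Fin 5)) 1 →
    ∀ (g : Literature.Geometry.Lorentzian.PseudoRiemannianMetric (𝓡 4) ∞ (EuclideanSpace ℝ (Fin 4))
        (TangentSpace (𝓡 4) : M → Type _)) [g.HasLeviCivita] (f : M → ℝ) (hg : g.IsRiemannian),
      ContMDiff (𝓡 4) 𝓘(ℝ, ℝ) ∞ f →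
      (∀ (x : M) (X Y : TangentSpace (𝓡 4) x),
        g.ricci x X Y + g.hessian f x X Y = (1 / 2 : ℝ) * g.val x X Y) →
      (∀ x : M, g.scalarCurvature x + g.gradSq f x = f x) →
      ENNReal.ofReal (32 * Real.pi ^ 2 * Real.sqrt Real.pi * Real.exp (-(3 : ℝ) / 2)) <
        ∫⁻ x, ENNReal.ofReal (Real.exp (-f x))
          ∂(Literature.Geometry.Lorentzian.riemannianMeasure (g.toContMDiffRiemannianMetric hg)) →
      ∫ x, (g.scalarCurvature x - 2) ^ 2
          ∂(Literature.Geometry.Lorentzian.riemannianMeasure (g.toContMDiffRiemannianMetric hg)) <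
        2 * ((Literature.Geometry.Lorentzian.riemannianMeasure (g.toContMDiffRiemannianMetric hg))
              Set.univ).toReal - 96 * Real.pi ^ 2 := by
  sorry

/-- **STUB 8 (dictionary, wave 2) — the pointwise Hessian/Ricci norm identity of a gradient
shrinker.** For a Riemannian `g` (Levi-Civita) on a 4-manifold and `f` with `Ric + Hess f = g/2`
pointwise: `|Hess f|²_g = |Ric|²_g + 1 − R` at every point (`Hess f = ½g − Ric` as bilinear forms,
`|½g|² = ¼·dim = 1`, `⟨g, Ric⟩_g = tr_g Ric = R`; metric square norm `normSq` = `T_{ij}T^{ij}`,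
computed in a `g`-orthonormal basis by `normSq_eq_sum_sq`, `exists_isOrthoᵢ_basis`,
`IsOrthonormalFrame.sum_ricci_eq_scalarCurvature`). Equivalently `|Hess f|² = |E|² + (R − 2)²/4`.
Check: round `S⁴(√6)`, `f ≡ 2`: `0 = 1 + 1 − 2`. [cite: CaoZhu2010, (3.6)–(3.7)]
[cite: ChengRibeiroZhou2022, Lemma 1] -/
theorem stub_normSqHessian :
    ∀ (M : Type) [TopologicalSpace M] [T2Space M] [SecondCountableTopology M]
      [ChartedSpace (EuclideanSpace ℝ (Fin 4)) M] [IsManifold (𝓡 4) ∞ M]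
      (g : Literature.Geometry.Lorentzian.PseudoRiemannianMetric (𝓡 4) ∞ (EuclideanSpace ℝ (Fin 4))
        (TangentSpace (𝓡 4) : M → Type _)) [g.HasLeviCivita] (f : M → ℝ), g.IsRiemannian →
      (∀ (x : M) (X Y : TangentSpace (𝓡 4) x),
        g.ricci x X Y + g.hessian f x X Y = (1 / 2 : ℝ) * g.val x X Y) →
      ∀ x : M, g.normSq x (g.hessian f x) = g.normSq x (g.ricci x) + 1 - g.scalarCurvature x :=
  -- LANDED (p74355, ACCEPTED): theorem alias of the Theorems decl (same statement, term-for-term)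
  Theorems.stub_normSqHessian

/-- **STUB 9 (dictionary, wave 2) — the unweighted Hessian energy of a closed gradient shrinker is
half the scalar-curvature variance: `∫|Hess f|² dV = ½ ∫(R − 2)² dV`.** On a closed 4-manifold with
Riemannian `g` (Levi-Civita), smooth `f`, `Ric + Hess f = g/2`, and GIVEN (B)
`ΔR = g⁻¹(dR, df) + R − 2|Ric|²` and the pointwise identity `|Hess f|² = |Ric|² + 1 − R` (STUB 8) for
this `(g,f)`: `R + Δf = 2` and `∫Δf = 0` give `∫R = 2V`; Green `∫g⁻¹(dR,df) = −∫RΔf = ∫R² − 4V` and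
`∫ΔR = 0` in (B) give `∫|Ric|² = ½∫R² − V`; hence `∫|Hess f|² = ½∫R² − 2V = ½∫(R − 2)²`
(the same bookkeeping as `Theorems.stub_sigmaTwo_of_identities`). So STUB 1 reads
`∫|Hess f|² dV < Vol − 48π²`. Check: round `S⁴(√6)`: `0 = 0`. [cite: ChengRibeiroZhou2022, Lemma 1 and p. 5]
[cite: CaoZhu2010, (3.6)–(3.7)] -/
theorem stub_hessianEnergy_of_identities :
    ∀ (M : Type) [TopologicalSpace M] [T2Space M] [SecondCountableTopology M]
      [ChartedSpace (EuclideanSpace ℝ (Fin 4)) M] [IsManifold (𝓡 4) ∞ M] [CompactSpace M]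
      [T3Space M] [MeasurableSpace M] [BorelSpace M]
      (g : Literature.Geometry.Lorentzian.PseudoRiemannianMetric (𝓡 4) ∞ (EuclideanSpace ℝ (Fin 4))
        (TangentSpace (𝓡 4) : M → Type _)) [g.HasLeviCivita] (f : M → ℝ) (hg : g.IsRiemannian),
      ContMDiff (𝓡 4) 𝓘(ℝ, ℝ) ∞ f →
      (∀ (x : M) (X Y : TangentSpace (𝓡 4) x),
        g.ricci x X Y + g.hessian f x X Y = (1 / 2 : ℝ) * g.val x X Y) →
      (∀ x : M, g.dalembertian g.scalarCurvature x =
        g.innerDual x (mvfderiv (𝓡 4) g.scalarCurvature x : TangentSpace (𝓡 4) x →ₗ[ℝ] ℝ)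
            (mvfderiv (𝓡 4) f x : TangentSpace (𝓡 4) x →ₗ[ℝ] ℝ) +
          g.scalarCurvature x - 2 * g.normSq x (g.ricci x)) →
      (∀ x : M, g.normSq x (g.hessian f x) = g.normSq x (g.ricci x) + 1 - g.scalarCurvature x) →
      ∫ x, g.normSq x (g.hessian f x)
          ∂(Literature.Geometry.Lorentzian.riemannianMeasure (g.toContMDiffRiemannianMetric hg)) =
        1 / 2 * ∫ x, (g.scalarCurvature x - 2) ^ 2
          ∂(Literature.Geometry.Lorentzian.riemannianMeasure (g.toContMDiffRiemannianMetric hg)) :=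
  -- LANDED (p74473, ACCEPTED): theorem alias of the Theorems decl (same statement, term-for-term)
  Theorems.stub_hessianEnergy_of_identities

/-- **STUB 10 (dictionary, wave 2) — the weighted Dirichlet energy of the potential of a closed
NORMALISED shrinker is its weighted variance: `∫|∇f|² e^{-f} dV = ∫(f − 2)² e^{-f} dV`.** On a
closed 4-manifold with Riemannian `g` (Levi-Civita), smooth `f`, `Ric + Hess f = g/2`,
`R + |∇f|² = f`: the traced equation `Δf = 2 − R = 2 − f + |∇f|²` (drift Laplacian `Δ_f f = 2 − f`)
and `Δ(e^{-f}) = (f − 2)e^{-f}` (`IsNormalisedShrinker.dalembertian_exp_neg`) give, by the product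
rule `Δ(f e^{-f}) = e^{-f}Δf + fΔe^{-f} + 2g⁻¹(df, de^{-f})` (`dalembertian_fun_mul`,
`de^{-f} = −e^{-f}df`) and `∫Δ(·) dV = 0` (`integral_dalembertian_riemVolume_eq_zero`):
`0 = ∫(2 − f + |∇f|²)e^{-f} + ∫f(f − 2)e^{-f} − 2∫|∇f|²e^{-f}`, and `∫(f − 2)e^{-f} = 0`
(`integral_mul_exp_neg_eq_two_mul`), whence the claim. Both sides are the weighted variance
`Var_{e^{-f}dV}(f)` (weighted mean of `f` is `2`). Check: round `S⁴(√6)`, `f ≡ 2`: `0 = 0`.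
[cite: CarrilloNi2009, §2 (2.1)–(2.3) and §4] [cite: CaoZhu2010, (3.6)–(3.7)] -/
theorem stub_weightedDirichlet :
    ∀ (M : Type) [TopologicalSpace M] [T2Space M] [SecondCountableTopology M]
      [ChartedSpace (EuclideanSpace ℝ (Fin 4)) M] [IsManifold (𝓡 4) ∞ M] [CompactSpace M]
      [T3Space M] [MeasurableSpace M] [BorelSpace M]
      (g : Literature.Geometry.Lorentzian.PseudoRiemannianMetric (𝓡 4) ∞ (EuclideanSpace ℝ (Fin 4))
        (TangentSpace (𝓡 4) : M → Type _)) [g.HasLeviCivita] (f : M → ℝ) (hg : g.IsRiemannian),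
      ContMDiff (𝓡 4) 𝓘(ℝ, ℝ) ∞ f →
      (∀ (x : M) (X Y : TangentSpace (𝓡 4) x),
        g.ricci x X Y + g.hessian f x X Y = (1 / 2 : ℝ) * g.val x X Y) →
      (∀ x : M, g.scalarCurvature x + g.gradSq f x = f x) →
      ∫ x, g.gradSq f x * Real.exp (-f x)
          ∂(Literature.Geometry.Lorentzian.riemannianMeasure (g.toContMDiffRiemannianMetric hg)) =
        ∫ x, (f x - 2) ^ 2 * Real.exp (-f x)
          ∂(Literature.Geometry.Lorentzian.riemannianMeasure (g.toContMDiffRiemannianMetric hg)) :=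
  -- LANDED (p74633, ACCEPTED): theorem alias of the Theorems decl (same statement, term-for-term)
  Theorems.stub_weightedDirichlet

/-- **STUB 11 (dictionary, wave 2) — the weighted Hessian energy of a closed normalised shrinker is
half its weighted Dirichlet energy: `∫|Hess f|² e^{-f} dV = ½ ∫|∇f|² e^{-f} dV`** (the integrated
weighted Bochner identity, obtained here WITHOUT a Bochner formula). On a closed 4-manifold with
Riemannian `g` (Levi-Civita), smooth `f`, `Ric + Hess f = g/2`, `R + |∇f|² = f`, GIVEN (B)
`ΔR = g⁻¹(dR, df) + R − 2|Ric|²` and `|Hess f|² = |Ric|² + 1 − R` (STUB 8): (B) says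
`Δ_f R = R − 2|Ric|²` for the drift Laplacian, and `∫(Δ_f R)e^{-f} dV = ∫(ΔR)e^{-f} − ∫g⁻¹(dR,df)e^{-f}
= ∫RΔ(e^{-f}) + ∫g⁻¹(dR, d(e^{-f})) = 0` (symmetric Green `integral_mul_dalembertian_riemVolume` twice /
`d(e^{-f}) = −e^{-f}df`), so `∫|Ric|²e^{-f} = ½∫Re^{-f}`; then
`∫|Hess f|²e^{-f} = ∫(|Ric|² + 1 − R)e^{-f} = ∫(1 − R/2)e^{-f} = ½∫(2 − f + |∇f|²)e^{-f} = ½∫|∇f|²e^{-f}`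
using `R = f − |∇f|²` and `∫(f − 2)e^{-f} = 0` (`integral_mul_exp_neg_eq_two_mul`). Check: round
`S⁴(√6)`: `0 = 0`; Gaussian soliton (paper): `|Hess f|² = 1`, `|∇f|² = |x|²/4`, both sides `16π²`.
[cite: CaoZhu2010, (3.6)–(3.7)] [cite: CarrilloNi2009, §4] -/
theorem stub_weightedHessianEnergy_of_identities :
    ∀ (M : Type) [TopologicalSpace M] [T2Space M] [SecondCountableTopology M]
      [ChartedSpace (EuclideanSpace ℝ (Fin 4)) M] [IsManifold (𝓡 4) ∞ M] [CompactSpace M]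
      [T3Space M] [MeasurableSpace M] [BorelSpace M]
      (g : Literature.Geometry.Lorentzian.PseudoRiemannianMetric (𝓡 4) ∞ (EuclideanSpace ℝ (Fin 4))
        (TangentSpace (𝓡 4) : M → Type _)) [g.HasLeviCivita] (f : M → ℝ) (hg : g.IsRiemannian),
      ContMDiff (𝓡 4) 𝓘(ℝ, ℝ) ∞ f →
      (∀ (x : M) (X Y : TangentSpace (𝓡 4) x),
        g.ricci x X Y + g.hessian f x X Y = (1 / 2 : ℝ) * g.val x X Y) →
      (∀ x : M, g.scalarCurvature x + g.gradSq f x = f x) →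
      (∀ x : M, g.dalembertian g.scalarCurvature x =
        g.innerDual x (mvfderiv (𝓡 4) g.scalarCurvature x : TangentSpace (𝓡 4) x →ₗ[ℝ] ℝ)
            (mvfderiv (𝓡 4) f x : TangentSpace (𝓡 4) x →ₗ[ℝ] ℝ) +
          g.scalarCurvature x - 2 * g.normSq x (g.ricci x)) →
      (∀ x : M, g.normSq x (g.hessian f x) = g.normSq x (g.ricci x) + 1 - g.scalarCurvature x) →
      ∫ x, g.normSq x (g.hessian f x) * Real.exp (-f x)
          ∂(Literature.Geometry.Lorentzian.riemannianMeasure (g.toContMDiffRiemannianMetric hg)) =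
        1 / 2 * ∫ x, g.gradSq f x * Real.exp (-f x)
          ∂(Literature.Geometry.Lorentzian.riemannianMeasure (g.toContMDiffRiemannianMetric hg)) :=
  -- LANDED (p74723, ACCEPTED): theorem alias of the Theorems decl (same statement, term-for-term)
  Theorems.stub_weightedHessianEnergy_of_identities

/-- **STUB 12 (dictionary, wave 3; LANDED p75235) — where the variance lives: `∫(R − 2)² dV = ∫|∇f|²(3 − R) dV` on a
closed NORMALISED shrinker.** On a closed 4-manifold with Riemannian `g` (Levi-Civita), smooth `f`,
`Ric + Hess f = g/2`, `R + |∇f|² = f`: `∫R = 2V` (traced equation `R + Δf = 2`, `∫Δf = 0`);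
`∫|∇f|² = ∫(f − R) = ∫f − 2V` (normalisation); Green `∫fΔf = −∫|∇f|²` with `Δf = 2 − R` gives
`∫fR = 2∫f + ∫|∇f|² = 3∫f − 2V`; hence `∫|∇f|²(3 − R) = ∫(f − R)(3 − R) = 3∫f − 3∫R − ∫fR + ∫R²
= ∫R² − 4V = ∫(R − 2)²`. (Equivalently, by `∫|Hess f|² = D/2` and Reilly's formula,
`D/2 = ∫Ric(∇f,∇f)`; no Bochner formula is needed along the route above.) Regions with `R > 3`
contribute NEGATIVELY to the variance; with `R > 0` it gives the crude sufficient condition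
`∫|∇f|² dV < (2V − 96π²)/3` for STUB 1 (`compactShrinkerGap_of_dirichletEnergy_lt`). Check: round
`S⁴(√6)`: `0 = 0`. [cite: ChengRibeiroZhou2022, Lemma 1 and §3.2] [cite: CaoZhu2010, (3.6)–(3.7)] -/
theorem stub_variance_eq_gradSq_mul :
    ∀ (M : Type) [TopologicalSpace M] [T2Space M] [SecondCountableTopology M]
      [ChartedSpace (EuclideanSpace ℝ (Fin 4)) M] [IsManifold (𝓡 4) ∞ M] [CompactSpace M]
      [T3Space M] [MeasurableSpace M] [BorelSpace M]
      (g : Literature.Geometry.Lorentzian.PseudoRiemannianMetric (𝓡 4) ∞ (EuclideanSpace ℝ (Fin 4))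
        (TangentSpace (𝓡 4) : M → Type _)) [g.HasLeviCivita] (f : M → ℝ) (hg : g.IsRiemannian),
      ContMDiff (𝓡 4) 𝓘(ℝ, ℝ) ∞ f →
      (∀ (x : M) (X Y : TangentSpace (𝓡 4) x),
        g.ricci x X Y + g.hessian f x X Y = (1 / 2 : ℝ) * g.val x X Y) →
      (∀ x : M, g.scalarCurvature x + g.gradSq f x = f x) →
      ∫ x, (g.scalarCurvature x - 2) ^ 2
          ∂(Literature.Geometry.Lorentzian.riemannianMeasure (g.toContMDiffRiemannianMetric hg)) =
        ∫ x, g.gradSq f x * (3 - g.scalarCurvature x)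
          ∂(Literature.Geometry.Lorentzian.riemannianMeasure (g.toContMDiffRiemannianMetric hg)) :=
  -- LANDED (p75235, ACCEPTED): theorem alias of the Theorems decl (same statement, term-for-term)
  Theorems.stub_variance_eq_gradSq_mul

/-! ## The Cheng–Ribeiro–Zhou stubs (v8): trace bound, defect identity, CRZ sharp / sign-kept bounds, `f ≤ 3` -/

/-- **STUB 13 (v8) — trace Cauchy–Schwarz for the Ricci tensor in dimension four: `R² ≤ 4|Ric|²_g`
pointwise.** For a Riemannian `g` (Levi-Civita) on a 4-manifold, at every point `x`,
`R(x)² ≤ 4·|Ric|²_g(x)` (`normSq = R_{ij}R^{ij}`): in a `g_x`-orthonormal basis `b`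
(`exists_basis_isOrthonormalFrame`, `normSq_eq_sum_sq`) `|Ric|² = Σᵢⱼ Ric(bⱼ,bᵢ)² ≥ Σᵢ Ric(bᵢ,bᵢ)²
≥ ¼(Σᵢ Ric(bᵢ,bᵢ))² = ¼R²` (Cauchy–Schwarz on `Fin 4`, `IsOrthonormalFrame.sum_ricci_eq_scalarCurvature`).
Equivalently `|E|² = |Ric|² − R²/4 ≥ 0`. Check: round `S⁴(√6)`: `4 ≤ 4·1`. [folklore] -/
theorem stub_scalarCurvature_sq_le :
    ∀ (M : Type) [TopologicalSpace M] [T2Space M] [SecondCountableTopology M]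
      [ChartedSpace (EuclideanSpace ℝ (Fin 4)) M] [IsManifold (𝓡 4) ∞ M]
      (g : Literature.Geometry.Lorentzian.PseudoRiemannianMetric (𝓡 4) ∞ (EuclideanSpace ℝ (Fin 4))
        (TangentSpace (𝓡 4) : M → Type _)) [g.HasLeviCivita], g.IsRiemannian →
      ∀ x : M, g.scalarCurvature x ^ 2 ≤ 4 * g.normSq x (g.ricci x) := by
  sorry

/-- **STUB 15 (v8) — the defect identity behind Cheng–Ribeiro–Zhou: for EVERY real `c`,
`∫(R − 2)² dV = ∫(R − 2|Ric|²)(e^{c−f} − 1) dV` on a closed gradient shrinker.** On a closed 4-manifold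
with Riemannian `g` (Levi-Civita), smooth `f`, `Ric + Hess f = g/2`, and GIVEN (B)
`ΔR = g⁻¹(dR, df) + R − 2|Ric|²` for this `(g, f)`: (B) says `Δ_f R = R − 2|Ric|²` for the drift Laplacian;
the weighted Green identity `∫(ΔR − g⁻¹(df, dR))e^{-f} dV = 0` (`integral_weightedLaplacian_eq_zero`) gives
`∫(R − 2|Ric|²)e^{-f} = 0`; the unweighted one `∫ΔR = 0` with Green `∫g⁻¹(dR, df) = −∫RΔf = ∫R² − 2∫R`
(`integral_mul_dalembertian_riemVolume`, `Δf = 2 − R`) and `∫R = 2V` (`∫Δf = 0`) gives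
`∫(R − 2|Ric|²) = −(∫R² − 4V) = −∫(R − 2)²`; subtract `e^{c}`·(first) − (second). The normalisation
`R + |∇f|² = f` is NOT used. Check: round `S⁴(√6)` (`R = 2`, `|Ric|² = 1`): `0 = 0`.
[cite: ChengRibeiroZhou2022, Lemma 1 and §3.2] [cite: CaoZhu2010, (3.6)–(3.7)] -/
theorem stub_variance_eq_integral_defect :
    ∀ (M : Type) [TopologicalSpace M] [T2Space M] [SecondCountableTopology M]
      [ChartedSpace (EuclideanSpace ℝ (Fin 4)) M] [IsManifold (𝓡 4) ∞ M] [CompactSpace M]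
      [T3Space M] [MeasurableSpace M] [BorelSpace M]
      (g : Literature.Geometry.Lorentzian.PseudoRiemannianMetric (𝓡 4) ∞ (EuclideanSpace ℝ (Fin 4))
        (TangentSpace (𝓡 4) : M → Type _)) [g.HasLeviCivita] (f : M → ℝ) (hg : g.IsRiemannian),
      ContMDiff (𝓡 4) 𝓘(ℝ, ℝ) ∞ f →
      (∀ (x : M) (X Y : TangentSpace (𝓡 4) x),
        g.ricci x X Y + g.hessian f x X Y = (1 / 2 : ℝ) * g.val x X Y) →
      (∀ x : M, g.dalembertian g.scalarCurvature x =
        g.innerDual x (mvfderiv (𝓡 4) g.scalarCurvature x : TangentSpace (𝓡 4) x →ₗ[ℝ] ℝ)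
            (mvfderiv (𝓡 4) f x : TangentSpace (𝓡 4) x →ₗ[ℝ] ℝ) +
          g.scalarCurvature x - 2 * g.normSq x (g.ricci x)) →
      ∀ c : ℝ,
      ∫ x, (g.scalarCurvature x - 2) ^ 2
          ∂(Literature.Geometry.Lorentzian.riemannianMeasure (g.toContMDiffRiemannianMetric hg)) =
        ∫ x, (g.scalarCurvature x - 2 * g.normSq x (g.ricci x)) * (Real.exp (c - f x) - 1)
          ∂(Literature.Geometry.Lorentzian.riemannianMeasure (g.toContMDiffRiemannianMetric hg)) := by
  sorry

/-- **STUB 14 (v8) — the Cheng–Ribeiro–Zhou sharp bound `∫(R − 2)² dV ≤ ½(e^{c}∫e^{-f} dV − Vol)` for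
`f ≤ c`, from the defect identity (STUB 15) and the trace bound (STUB 13) as hypotheses.** On a closed
4-manifold with Riemannian `g` (Levi-Civita) and smooth `f ≤ c`, GIVEN `R² ≤ 4|Ric|²` pointwise and
`∫(R − 2)² = ∫(R − 2|Ric|²)(e^{c−f} − 1)`: pointwise `R − 2|Ric|² ≤ R − R²/2 = ½(1 − (R − 1)²) ≤ ½` and
`e^{c−f} − 1 ≥ 0`, so `∫(R − 2)² ≤ ½∫(e^{c−f} − 1) = ½(e^{c}∫e^{-f} − Vol)` (integrands continuous on the
compact `M`: `contMDiff_scalarCurvature`, `contMDiff_normSq_ricci'`; `riemVolume_eq`). Equality at the round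
shrinker with `c = 2`. This is the printed bound of CRZ 2023 §3.2 (`Φ′(b) ≤ ½e^{b}∫Vol(D(t))e^{-t}dt`) without
the coarea formula. [cite: ChengRibeiroZhou2022, §3.2 and Rem. 2] -/
theorem stub_crzSharpBound_of_identities :
    ∀ (M : Type) [TopologicalSpace M] [T2Space M] [SecondCountableTopology M]
      [ChartedSpace (EuclideanSpace ℝ (Fin 4)) M] [IsManifold (𝓡 4) ∞ M] [CompactSpace M]
      [T3Space M] [MeasurableSpace M] [BorelSpace M]
      (g : Literature.Geometry.Lorentzian.PseudoRiemannianMetric (𝓡 4) ∞ (EuclideanSpace ℝ (Fin 4))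
        (TangentSpace (𝓡 4) : M → Type _)) [g.HasLeviCivita] (f : M → ℝ) (hg : g.IsRiemannian),
      ContMDiff (𝓡 4) 𝓘(ℝ, ℝ) ∞ f →
      (∀ x : M, g.scalarCurvature x ^ 2 ≤ 4 * g.normSq x (g.ricci x)) →
      ∀ c : ℝ, (∀ x : M, f x ≤ c) →
      ∫ x, (g.scalarCurvature x - 2) ^ 2
          ∂(Literature.Geometry.Lorentzian.riemannianMeasure (g.toContMDiffRiemannianMetric hg)) =
        ∫ x, (g.scalarCurvature x - 2 * g.normSq x (g.ricci x)) * (Real.exp (c - f x) - 1)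
          ∂(Literature.Geometry.Lorentzian.riemannianMeasure (g.toContMDiffRiemannianMetric hg)) →
      ∫ x, (g.scalarCurvature x - 2) ^ 2
          ∂(Literature.Geometry.Lorentzian.riemannianMeasure (g.toContMDiffRiemannianMetric hg)) ≤
        1 / 2 * (Real.exp c *
            ∫ x, Real.exp (-f x)
              ∂(Literature.Geometry.Lorentzian.riemannianMeasure (g.toContMDiffRiemannianMetric hg)) -
          ((Literature.Geometry.Lorentzian.riemannianMeasure (g.toContMDiffRiemannianMetric hg))
            Set.univ).toReal) := by
  sorry

/-- **STUB 16 (v8) — the SIGN-KEPT Cheng–Ribeiro–Zhou bound `∫(R − 2)² dV ≤ ½∫R(2 − R)(e^{c−f} − 1) dV`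
for `f ≤ c`** (Disproof §13's sharper paper form; the integrand is negative where `R > 2`), from the same
two hypotheses as STUB 14: pointwise `R − 2|Ric|² ≤ R − R²/2 = ½R(2 − R)` (trace bound) against the
non-negative weight `e^{c−f} − 1`. Equality iff `E ≡ 0` on `{f < c}`. On Koiso–Cao (numerics, Disproof §9/§13)
the right side is `70.2` vs `D = 58.3` (the crude form gives `196.3`). [cite: ChengRibeiroZhou2022, §3.2 and Rem. 2] -/
theorem stub_crzSignKept_of_identities :
    ∀ (M : Type) [TopologicalSpace M] [T2Space M] [SecondCountableTopology M]
      [ChartedSpace (EuclideanSpace ℝ (Fin 4)) M] [IsManifold (𝓡 4) ∞ M] [CompactSpace M]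
      [T3Space M] [MeasurableSpace M] [BorelSpace M]
      (g : Literature.Geometry.Lorentzian.PseudoRiemannianMetric (𝓡 4) ∞ (EuclideanSpace ℝ (Fin 4))
        (TangentSpace (𝓡 4) : M → Type _)) [g.HasLeviCivita] (f : M → ℝ) (hg : g.IsRiemannian),
      ContMDiff (𝓡 4) 𝓘(ℝ, ℝ) ∞ f →
      (∀ x : M, g.scalarCurvature x ^ 2 ≤ 4 * g.normSq x (g.ricci x)) →
      ∀ c : ℝ, (∀ x : M, f x ≤ c) →
      ∫ x, (g.scalarCurvature x - 2) ^ 2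
          ∂(Literature.Geometry.Lorentzian.riemannianMeasure (g.toContMDiffRiemannianMetric hg)) =
        ∫ x, (g.scalarCurvature x - 2 * g.normSq x (g.ricci x)) * (Real.exp (c - f x) - 1)
          ∂(Literature.Geometry.Lorentzian.riemannianMeasure (g.toContMDiffRiemannianMetric hg)) →
      ∫ x, (g.scalarCurvature x - 2) ^ 2
          ∂(Literature.Geometry.Lorentzian.riemannianMeasure (g.toContMDiffRiemannianMetric hg)) ≤
        1 / 2 * ∫ x, g.scalarCurvature x * (2 - g.scalarCurvature x) * (Real.exp (c - f x) - 1)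
          ∂(Literature.Geometry.Lorentzian.riemannianMeasure (g.toContMDiffRiemannianMetric hg)) := by
  sorry

/-- **STUB 7 (re-registered in v8; OPEN, the CRZ sub-line's transfer target, stronger than STUB 1).** For
the crux data (closed `M ≃ₕ S⁴`, Riemannian `g` with Levi-Civita connection, smooth `f`, `Ric + Hess f = g/2`,
`R + |∇f|² = f`, `∫ e^{-f} dV > 32π²√π e^{-3/2}`): `f ≤ 3` everywhere, i.e. `R_max = f_max ≤ 3` (at a maximum
of `f`, `∇f = 0` so `R = f`). With STUBS 13–16 landed, `f ≤ 3` ⇒ (CRZ sharp at `c = 3`, Jensen `Z ≤ e^{-2}V`,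
`V > e²Z₀`, `(5 − e)√π e^{1/2} > 6`) STUB 1 (`varianceBudget_of_potentialLeThree`). The window is `f_max ∈ [2, 3]`
(`f_max = 2` iff Einstein); ceiling of the method `c* = 2 + log(5 − 6/(√π e^{1/2})) = 3.0807` (Disproof §11,
p71615); false without closedness (Gaussian shrinker, p71580); every known compact 4-d shrinker has
`f_max ≤ 2.53` (Koiso–Cao), every member of Donovan's orbifold family with `f_max > 3` is sparse (`Θ ≤ .34`).
A sup bound from an integral (entropy) hypothesis is the HARD direction: no printed theorem links `sup f` to
`Θ`; falsifiable on the standard `S⁴` by a dense shrinker with `R_max > 3`.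
[cite: ChengRibeiroZhou2022, Rem. 1–2] [cite: CaoHamiltonIlmanen2004, §4] -/
theorem stub_potentialLeThree :
    ∀ (M : Type) [TopologicalSpace M] [T2Space M] [SecondCountableTopology M]
      [ChartedSpace (EuclideanSpace ℝ (Fin 4)) M] [IsManifold (𝓡 4) ∞ M] [CompactSpace M]
      [T3Space M] [MeasurableSpace M] [BorelSpace M],
      M ≃ₕ Metric.sphere (0 : EuclideanSpace ℝ (Fin 5)) 1 →
    ∀ (g : Literature.Geometry.Lorentzian.PseudoRiemannianMetric (𝓡 4) ∞ (EuclideanSpace ℝ (Fin 4))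
        (TangentSpace (𝓡 4) : M → Type _)) [g.HasLeviCivita] (f : M → ℝ) (hg : g.IsRiemannian),
      ContMDiff (𝓡 4) 𝓘(ℝ, ℝ) ∞ f →
      (∀ (x : M) (X Y : TangentSpace (𝓡 4) x),
        g.ricci x X Y + g.hessian f x X Y = (1 / 2 : ℝ) * g.val x X Y) →
      (∀ x : M, g.scalarCurvature x + g.gradSq f x = f x) →
      ENNReal.ofReal (32 * Real.pi ^ 2 * Real.sqrt Real.pi * Real.exp (-(3 : ℝ) / 2)) <
        ∫⁻ x, ENNReal.ofReal (Real.exp (-f x))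
          ∂(Literature.Geometry.Lorentzian.riemannianMeasure (g.toContMDiffRiemannianMetric hg)) →
      ∀ x : M, f x ≤ 3 := by
  sorry

/-- **The Cheng–Ribeiro–Zhou sharp bound for closed gradient shrinkers, COMPOSED (v8; sorry-free given
STUBS 13–15):** for Riemannian `g` (Levi-Civita) on a closed 4-manifold and smooth `f` with `Ric + Hess f = g/2`,
every `c ≥ sup f` satisfies `∫(R − 2)² dV ≤ ½(e^{c}∫e^{-f} dV − Vol)`. (B) comes from the landed
`Theorems.stub_shrinkerScalarIdentities` (p71473). This is the statement that v1–v7 carried as the named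
hypothesis `CRZSharpBound`. [cite: ChengRibeiroZhou2022, §3.2 and Rem. 2] -/
theorem crzSharpBound
    (M : Type) [TopologicalSpace M] [T2Space M] [SecondCountableTopology M]
    [ChartedSpace (EuclideanSpace ℝ (Fin 4)) M] [IsManifold (𝓡 4) ∞ M] [CompactSpace M]
    [T3Space M] [MeasurableSpace M] [BorelSpace M]
    (g : Literature.Geometry.Lorentzian.PseudoRiemannianMetric (𝓡 4) ∞ (EuclideanSpace ℝ (Fin 4))
      (TangentSpace (𝓡 4) : M → Type _)) [g.HasLeviCivita] (f : M → ℝ) (hg : g.IsRiemannian)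
    (hf : ContMDiff (𝓡 4) 𝓘(ℝ, ℝ) ∞ f)
    (hsol : ∀ (x : M) (X Y : TangentSpace (𝓡 4) x),
      g.ricci x X Y + g.hessian f x X Y = (1 / 2 : ℝ) * g.val x X Y)
    (c : ℝ) (hfc : ∀ x : M, f x ≤ c) :
    ∫ x, (g.scalarCurvature x - 2) ^ 2
        ∂(Literature.Geometry.Lorentzian.riemannianMeasure (g.toContMDiffRiemannianMetric hg)) ≤
      1 / 2 * (Real.exp c *
          ∫ x, Real.exp (-f x)
            ∂(Literature.Geometry.Lorentzian.riemannianMeasure (g.toContMDiffRiemannianMetric hg)) -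
        ((Literature.Geometry.Lorentzian.riemannianMeasure (g.toContMDiffRiemannianMetric hg))
          Set.univ).toReal) := by
  obtain ⟨_, hB⟩ := Theorems.stub_shrinkerScalarIdentities M g f hg hf hsol
  have hT := stub_scalarCurvature_sq_le M g hg
  have hI := stub_variance_eq_integral_defect M g f hg hf hsol hB c
  exact stub_crzSharpBound_of_identities M g f hg hf hT c hfc hI

/-- **The sign-kept CRZ bound, COMPOSED (v8; sorry-free given STUBS 13, 15, 16):** for `c ≥ sup f`,
`∫(R − 2)² dV ≤ ½∫R(2 − R)(e^{c−f} − 1) dV`. [cite: ChengRibeiroZhou2022, §3.2 and Rem. 2] -/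
theorem crzSignKeptBound
    (M : Type) [TopologicalSpace M] [T2Space M] [SecondCountableTopology M]
    [ChartedSpace (EuclideanSpace ℝ (Fin 4)) M] [IsManifold (𝓡 4) ∞ M] [CompactSpace M]
    [T3Space M] [MeasurableSpace M] [BorelSpace M]
    (g : Literature.Geometry.Lorentzian.PseudoRiemannianMetric (𝓡 4) ∞ (EuclideanSpace ℝ (Fin 4))
      (TangentSpace (𝓡 4) : M → Type _)) [g.HasLeviCivita] (f : M → ℝ) (hg : g.IsRiemannian)
    (hf : ContMDiff (𝓡 4) 𝓘(ℝ, ℝ) ∞ f)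
    (hsol : ∀ (x : M) (X Y : TangentSpace (𝓡 4) x),
      g.ricci x X Y + g.hessian f x X Y = (1 / 2 : ℝ) * g.val x X Y)
    (c : ℝ) (hfc : ∀ x : M, f x ≤ c) :
    ∫ x, (g.scalarCurvature x - 2) ^ 2
        ∂(Literature.Geometry.Lorentzian.riemannianMeasure (g.toContMDiffRiemannianMetric hg)) ≤
      1 / 2 * ∫ x, g.scalarCurvature x * (2 - g.scalarCurvature x) * (Real.exp (c - f x) - 1)
        ∂(Literature.Geometry.Lorentzian.riemannianMeasure (g.toContMDiffRiemannianMetric hg)) := by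
  obtain ⟨_, hB⟩ := Theorems.stub_shrinkerScalarIdentities M g f hg hf hsol
  have hT := stub_scalarCurvature_sq_le M g hg
  have hI := stub_variance_eq_integral_defect M g f hg hf hsol hB c
  exact stub_crzSignKept_of_identities M g f hg hf hT c hfc hI

/-! ## The composition (PRIMARY, Chern–Gauss–Bonnet-free): STUB W + landed `R > 0` + `π₁ = 1` ⇒ the crux, under `hCGY` -/

/-- **The finisher from the Weyl budget** (CGB-free; conditional only on the route crux
`hCGY = EntropyRung.ChangGurskyYang`). For a closed `M ≃ₕ S⁴` with a gradient shrinker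
`Ric + Hess f = g/2` (smooth `f`, Riemannian `g`) of Weyl energy `< 32π²`: `π₁(M) = 1`
(`simplyConnectedSpace_of_homotopyEquiv_sphere_four`, PROVED), `R > 0` (landed
`Theorems.stub_scalarCurvaturePos_of_identities` with (B) from `Theorems.stub_shrinkerScalarIdentities`), and
CGY Thm A returns `M ≃ₘ S⁴`. [cite: ChangGurskyYang2003, Thm. A] -/
theorem diffeomorph_sphere_of_weylBudget (hCGY : ChangGurskyYang)
    (M : Type) [TopologicalSpace M] [T2Space M] [SecondCountableTopology M]
    [ChartedSpace (EuclideanSpace ℝ (Fin 4)) M] [IsManifold (𝓡 4) ∞ M] [CompactSpace M]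
    (e : M ≃ₕ Metric.sphere (0 : EuclideanSpace ℝ (Fin 5)) 1)
    (g : Literature.Geometry.Lorentzian.PseudoRiemannianMetric (𝓡 4) ∞ (EuclideanSpace ℝ (Fin 4))
      (TangentSpace (𝓡 4) : M → Type _)) [g.HasLeviCivita] (f : M → ℝ) (hg : g.IsRiemannian)
    (hf : ContMDiff (𝓡 4) 𝓘(ℝ, ℝ) ∞ f)
    (hsol : ∀ (x : M) (X Y : TangentSpace (𝓡 4) x),
      g.ricci x X Y + g.hessian f x X Y = (1 / 2 : ℝ) * g.val x X Y)
    (hW : g.weylEnergy < ENNReal.ofReal (32 * Real.pi ^ 2)) :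
    Nonempty (M ≃ₘ⟮𝓡 4, 𝓡 4⟯ (Metric.sphere (0 : EuclideanSpace ℝ (Fin 5)) 1)) := by
  haveI : SimplyConnectedSpace M :=
    Literature.Topology.FourManifolds.simplyConnectedSpace_of_homotopyEquiv_sphere_four
      Literature.Topology.FourManifolds.simplyConnectedSpace_sphere_four_holds M e
  obtain ⟨_, hB⟩ := Theorems.stub_shrinkerScalarIdentities M g f hg hf hsol
  have hR : ∀ x : M, 0 < g.scalarCurvature x :=
    Theorems.stub_scalarCurvaturePos_of_identities M g f hg hf hsol hB
  exact hCGY M ⟨g, ‹_›, hg, hR, hW⟩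

/-- **`CompactShrinkerGap` from the route crux `ChangGurskyYang`** — THE SKELETON THEOREM (v7): the crux
BY NAME under the hypothesis `hCGY : EntropyRung.ChangGurskyYang` (stmt-10834), the Weyl budget supplied by
the transfer target `stub_weylBudget` (STUB W), the diffeomorphism by `diffeomorph_sphere_of_weylBudget`.
No Chern–Gauss–Bonnet. [cite: ChangGurskyYang2003, Thm. A] -/
theorem CompactShrinkerGap_of (hCGY : ChangGurskyYang) : CompactShrinkerGap := by
  intro M _ _ _ _ _ _ _ _ _ e g _ f hg hf hsol hnorm hdens
  exact diffeomorph_sphere_of_weylBudget hCGY M e g f hg hf hsol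
    (stub_weylBudget M e g f hg hf hsol hnorm hdens)

/-! ## The dictionary STUB W ⟺ STUB 1 (Chern–Gauss–Bonnet as an explicit named-fact hypothesis `hCGB`) -/

/-- **The Weyl energy of a closed gradient shrinker on a homotopy 4-sphere in soliton scalars**:
GIVEN the Chern–Gauss–Bonnet formula (`hCGB`, named fact p72262) — `∫|W|² = 64π² − ⅔·Vol + ⅓∫(R − 2)² dV`
(`χ(M ≃ₕ S⁴) = 2` is PROVED, `finRelHomology_of_homotopyEquiv_sphere_four`; `∫σ₂ = V/6 − D/12` is the
landed `Theorems.stub_sigmaTwo_of_identities`; `∫|W|² < ∞` by `weylEnergy_lt_top`). Round `S⁴(√6)`: `0 = 64π² − 64π² + 0`.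
[cite: ChangGurskyYang2003, (1.1) p. 111] [cite: Besse1987, 6.31] -/
theorem weylEnergy_toReal_eq (hCGB : Literature.Geometry.Riemannian.chernGaussBonnet_four)
    (M : Type) [TopologicalSpace M] [T2Space M] [SecondCountableTopology M]
    [ChartedSpace (EuclideanSpace ℝ (Fin 4)) M] [IsManifold (𝓡 4) ∞ M] [CompactSpace M]
    [T3Space M] [MeasurableSpace M] [BorelSpace M]
    (e : M ≃ₕ Metric.sphere (0 : EuclideanSpace ℝ (Fin 5)) 1)
    (g : Literature.Geometry.Lorentzian.PseudoRiemannianMetric (𝓡 4) ∞ (EuclideanSpace ℝ (Fin 4))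
      (TangentSpace (𝓡 4) : M → Type _)) [g.HasLeviCivita] (f : M → ℝ) (hg : g.IsRiemannian)
    (hf : ContMDiff (𝓡 4) 𝓘(ℝ, ℝ) ∞ f)
    (hsol : ∀ (x : M) (X Y : TangentSpace (𝓡 4) x),
      g.ricci x X Y + g.hessian f x X Y = (1 / 2 : ℝ) * g.val x X Y) :
    g.weylEnergy.toReal = 64 * Real.pi ^ 2 -
      2 / 3 * ((Literature.Geometry.Lorentzian.riemannianMeasure (g.toContMDiffRiemannianMetric hg))
        Set.univ).toReal +
      1 / 3 * ∫ x, (g.scalarCurvature x - 2) ^ 2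
        ∂(Literature.Geometry.Lorentzian.riemannianMeasure (g.toContMDiffRiemannianMetric hg)) := by
  have hχ : Literature.AlgebraicTopology.SingularHomology.relEuler ℤ ℤ M ∅ = 2 :=
    (Literature.Topology.FourManifolds.finRelHomology_of_homotopyEquiv_sphere_four e).2
  obtain ⟨_, hB⟩ := Theorems.stub_shrinkerScalarIdentities M g f hg hf hsol
  have hσ := Theorems.stub_sigmaTwo_of_identities M g f hg hf hsol hB
  have h := hCGB M g hg
  rw [hχ] at h
  push_cast at h
  linarith

/-- **STUB W ⟺ STUB 1 for the crux data, given Chern–Gauss–Bonnet**: `∫|W|² < 32π² ⟺ ∫(R − 2)² dV <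
2·Vol − 96π²` (from `weylEnergy_toReal_eq`; `weylEnergy` is finite on the closed manifold). [cite: ChangGurskyYang2003, (1.1) and Thm. A] -/
theorem weylBudget_iff_varianceBudget (hCGB : Literature.Geometry.Riemannian.chernGaussBonnet_four)
    (M : Type) [TopologicalSpace M] [T2Space M] [SecondCountableTopology M]
    [ChartedSpace (EuclideanSpace ℝ (Fin 4)) M] [IsManifold (𝓡 4) ∞ M] [CompactSpace M]
    [T3Space M] [MeasurableSpace M] [BorelSpace M]
    (e : M ≃ₕ Metric.sphere (0 : EuclideanSpace ℝ (Fin 5)) 1)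
    (g : Literature.Geometry.Lorentzian.PseudoRiemannianMetric (𝓡 4) ∞ (EuclideanSpace ℝ (Fin 4))
      (TangentSpace (𝓡 4) : M → Type _)) [g.HasLeviCivita] (f : M → ℝ) (hg : g.IsRiemannian)
    (hf : ContMDiff (𝓡 4) 𝓘(ℝ, ℝ) ∞ f)
    (hsol : ∀ (x : M) (X Y : TangentSpace (𝓡 4) x),
      g.ricci x X Y + g.hessian f x X Y = (1 / 2 : ℝ) * g.val x X Y) :
    g.weylEnergy < ENNReal.ofReal (32 * Real.pi ^ 2) ↔
      ∫ x, (g.scalarCurvature x - 2) ^ 2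
          ∂(Literature.Geometry.Lorentzian.riemannianMeasure (g.toContMDiffRiemannianMetric hg)) <
        2 * ((Literature.Geometry.Lorentzian.riemannianMeasure (g.toContMDiffRiemannianMetric hg))
              Set.univ).toReal - 96 * Real.pi ^ 2 := by
  rw [ENNReal.lt_ofReal_iff_toReal_lt (g.weylEnergy_lt_top hg).ne,
    weylEnergy_toReal_eq hCGB M e g f hg hf hsol]
  constructor <;> intro h <;> linarith

/-- **The finisher from the variance budget** (v1–v6 finisher, now with the CGB formula as the explicit
named-fact hypothesis `hCGB` instead of a stub): `D < 2·Vol − 96π²` ⇒ (CGB, `χ = 2`, `∫σ₂ = V/6 − D/12`)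
`∫|W|² < 32π²` ⇒ (`diffeomorph_sphere_of_weylBudget`) `M ≃ₘ S⁴`. [cite: ChangGurskyYang2003, Thm. A and (1.1)] -/
theorem diffeomorph_sphere_of_varianceBudget (hCGY : ChangGurskyYang)
    (hCGB : Literature.Geometry.Riemannian.chernGaussBonnet_four)
    (M : Type) [TopologicalSpace M] [T2Space M] [SecondCountableTopology M]
    [ChartedSpace (EuclideanSpace ℝ (Fin 4)) M] [IsManifold (𝓡 4) ∞ M] [CompactSpace M]
    [T3Space M] [MeasurableSpace M] [BorelSpace M]
    (e : M ≃ₕ Metric.sphere (0 : EuclideanSpace ℝ (Fin 5)) 1)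
    (g : Literature.Geometry.Lorentzian.PseudoRiemannianMetric (𝓡 4) ∞ (EuclideanSpace ℝ (Fin 4))
      (TangentSpace (𝓡 4) : M → Type _)) [g.HasLeviCivita] (f : M → ℝ) (hg : g.IsRiemannian)
    (hf : ContMDiff (𝓡 4) 𝓘(ℝ, ℝ) ∞ f)
    (hsol : ∀ (x : M) (X Y : TangentSpace (𝓡 4) x),
      g.ricci x X Y + g.hessian f x X Y = (1 / 2 : ℝ) * g.val x X Y)
    (hbudget : ∫ x, (g.scalarCurvature x - 2) ^ 2
          ∂(Literature.Geometry.Lorentzian.riemannianMeasure (g.toContMDiffRiemannianMetric hg)) <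
        2 * ((Literature.Geometry.Lorentzian.riemannianMeasure (g.toContMDiffRiemannianMetric hg))
              Set.univ).toReal - 96 * Real.pi ^ 2) :
    Nonempty (M ≃ₘ⟮𝓡 4, 𝓡 4⟯ (Metric.sphere (0 : EuclideanSpace ℝ (Fin 5)) 1)) :=
  diffeomorph_sphere_of_weylBudget hCGY M e g f hg hf hsol
    ((weylBudget_iff_varianceBudget hCGB M e g f hg hf hsol).2 hbudget)

/-- **`CompactShrinkerGap` from the variance budget (STUB 1), `hCGY` and the CGB fact `hCGB`** — the v1–v6
composition, kept as the ALTERNATIVE: it is how an attacker who proves the budget in soliton scalars closes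
the crux (conditional on the named fact `chernGaussBonnet_four` unless that is discharged or promoted).
[cite: ChangGurskyYang2003, Thm. A and (1.1)] -/
theorem CompactShrinkerGap_of_varianceBudget (hCGY : ChangGurskyYang)
    (hCGB : Literature.Geometry.Riemannian.chernGaussBonnet_four) : CompactShrinkerGap := by
  intro M _ _ _ _ _ _ _ _ _ e g _ f hg hf hsol hnorm hdens
  exact diffeomorph_sphere_of_varianceBudget hCGY hCGB M e g f hg hf hsol
    (stub_varianceBudget M e g f hg hf hsol hnorm hdens)

/-! ## Alternative compositions (landed sufficient conditions for STUB 1; each under `hCGY` + the CGB fact `hCGB`) -/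

/-- **The Einstein sub-case of the crux along this line** (= line `decay-climb-numax`'s
`stub_einsteinEndgame`, here from the landed Einstein-case budget + the finisher, i.e. modulo the CGB
fact and the CGY crux instead of Gursky 2000 + Hamilton PIC). [cite: ChangGurskyYang2003, Thm. A] -/
theorem compactShrinkerGap_einstein (hCGY : ChangGurskyYang)
    (hCGB : Literature.Geometry.Riemannian.chernGaussBonnet_four) :
    ∀ (M : Type) [TopologicalSpace M] [T2Space M] [SecondCountableTopology M]
      [ChartedSpace (EuclideanSpace ℝ (Fin 4)) M] [IsManifold (𝓡 4) ∞ M] [CompactSpace M]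
      [T3Space M] [MeasurableSpace M] [BorelSpace M],
      M ≃ₕ Metric.sphere (0 : EuclideanSpace ℝ (Fin 5)) 1 →
    ∀ (g : Literature.Geometry.Lorentzian.PseudoRiemannianMetric (𝓡 4) ∞ (EuclideanSpace ℝ (Fin 4))
        (TangentSpace (𝓡 4) : M → Type _)) [g.HasLeviCivita] (f : M → ℝ) (hg : g.IsRiemannian),
      ContMDiff (𝓡 4) 𝓘(ℝ, ℝ) ∞ f →
      (∀ (x : M) (X Y : TangentSpace (𝓡 4) x),
        g.ricci x X Y + g.hessian f x X Y = (1 / 2 : ℝ) * g.val x X Y) →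
      (∀ x : M, g.scalarCurvature x + g.gradSq f x = f x) →
      ENNReal.ofReal (32 * Real.pi ^ 2 * Real.sqrt Real.pi * Real.exp (-(3 : ℝ) / 2)) <
        ∫⁻ x, ENNReal.ofReal (Real.exp (-f x))
          ∂(Literature.Geometry.Lorentzian.riemannianMeasure (g.toContMDiffRiemannianMetric hg)) →
      (∀ (x : M) (X Y : TangentSpace (𝓡 4) x), g.hessian f x X Y = 0) →
      Nonempty (M ≃ₘ⟮𝓡 4, 𝓡 4⟯ (Metric.sphere (0 : EuclideanSpace ℝ (Fin 5)) 1)) := by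
  intro M _ _ _ _ _ _ _ _ _ e g _ f hg hf hsol hnorm hdens hE
  exact diffeomorph_sphere_of_varianceBudget hCGY hCGB M e g f hg hf hsol
    (Theorems.stub_varianceBudget_of_einstein M e g f hg hf hsol hnorm hdens hE)

/-- **The crux under the pointwise bound `R ≤ 2.48`** (landed `Theorems.stub_varianceBudget_of_scalarCurvature_le`,
p73066, + the finisher): Bhatia–Davis-type bookkeeping `0 ≤ R ≤ 2.48`, `∫R = 2V` gives `D ≤ 0.96V < 2V − 96π²`
by the Jensen floor `V > 92.8π²`. [cite: ChengRibeiroZhou2022, Rem. 2] [cite: ChangGurskyYang2003, Thm. A] -/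
theorem compactShrinkerGap_of_scalarCurvature_le (hCGY : ChangGurskyYang)
    (hCGB : Literature.Geometry.Riemannian.chernGaussBonnet_four) :
    ∀ (M : Type) [TopologicalSpace M] [T2Space M] [SecondCountableTopology M]
      [ChartedSpace (EuclideanSpace ℝ (Fin 4)) M] [IsManifold (𝓡 4) ∞ M] [CompactSpace M]
      [T3Space M] [MeasurableSpace M] [BorelSpace M],
      M ≃ₕ Metric.sphere (0 : EuclideanSpace ℝ (Fin 5)) 1 →
    ∀ (g : Literature.Geometry.Lorentzian.PseudoRiemannianMetric (𝓡 4) ∞ (EuclideanSpace ℝ (Fin 4))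
        (TangentSpace (𝓡 4) : M → Type _)) [g.HasLeviCivita] (f : M → ℝ) (hg : g.IsRiemannian),
      ContMDiff (𝓡 4) 𝓘(ℝ, ℝ) ∞ f →
      (∀ (x : M) (X Y : TangentSpace (𝓡 4) x),
        g.ricci x X Y + g.hessian f x X Y = (1 / 2 : ℝ) * g.val x X Y) →
      (∀ x : M, g.scalarCurvature x + g.gradSq f x = f x) →
      ENNReal.ofReal (32 * Real.pi ^ 2 * Real.sqrt Real.pi * Real.exp (-(3 : ℝ) / 2)) <
        ∫⁻ x, ENNReal.ofReal (Real.exp (-f x))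
          ∂(Literature.Geometry.Lorentzian.riemannianMeasure (g.toContMDiffRiemannianMetric hg)) →
      (∀ x : M, g.scalarCurvature x ≤ 2.48) →
      Nonempty (M ≃ₘ⟮𝓡 4, 𝓡 4⟯ (Metric.sphere (0 : EuclideanSpace ℝ (Fin 5)) 1)) := by
  intro M _ _ _ _ _ _ _ _ _ e g _ f hg hf hsol hnorm hdens hRle
  exact diffeomorph_sphere_of_varianceBudget hCGY hCGB M e g f hg hf hsol
    (Theorems.stub_varianceBudget_of_scalarCurvature_le M e g f hg hf hsol hnorm hdens hRle)

/-- **The crux from a Hessian-energy bound** — STUB 1 in its Hessian form: for the crux data,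
`∫|Hess f|² dV < Vol − 48π²` gives `M ≃ₘ S⁴` (STUBS 8–9 turn it into `∫(R − 2)² dV < 2Vol − 96π²`,
then the finisher). The density hypothesis is not even used here: it is what a PROOF of the Hessian
bound must spend (Disproof §12). [cite: CaoZhu2010, (3.6)–(3.7)] [cite: ChangGurskyYang2003, Thm. A] -/
theorem compactShrinkerGap_of_hessianEnergy_lt (hCGY : ChangGurskyYang)
    (hCGB : Literature.Geometry.Riemannian.chernGaussBonnet_four)
    (M : Type) [TopologicalSpace M] [T2Space M] [SecondCountableTopology M]
    [ChartedSpace (EuclideanSpace ℝ (Fin 4)) M] [IsManifold (𝓡 4) ∞ M] [CompactSpace M]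
    [T3Space M] [MeasurableSpace M] [BorelSpace M]
    (e : M ≃ₕ Metric.sphere (0 : EuclideanSpace ℝ (Fin 5)) 1)
    (g : Literature.Geometry.Lorentzian.PseudoRiemannianMetric (𝓡 4) ∞ (EuclideanSpace ℝ (Fin 4))
      (TangentSpace (𝓡 4) : M → Type _)) [g.HasLeviCivita] (f : M → ℝ) (hg : g.IsRiemannian)
    (hf : ContMDiff (𝓡 4) 𝓘(ℝ, ℝ) ∞ f)
    (hsol : ∀ (x : M) (X Y : TangentSpace (𝓡 4) x),
      g.ricci x X Y + g.hessian f x X Y = (1 / 2 : ℝ) * g.val x X Y)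
    (hHess : ∫ x, g.normSq x (g.hessian f x)
          ∂(Literature.Geometry.Lorentzian.riemannianMeasure (g.toContMDiffRiemannianMetric hg)) <
        ((Literature.Geometry.Lorentzian.riemannianMeasure (g.toContMDiffRiemannianMetric hg))
            Set.univ).toReal - 48 * Real.pi ^ 2) :
    Nonempty (M ≃ₘ⟮𝓡 4, 𝓡 4⟯ (Metric.sphere (0 : EuclideanSpace ℝ (Fin 5)) 1)) := by
  obtain ⟨_, hB⟩ := Theorems.stub_shrinkerScalarIdentities M g f hg hf hsol
  have hH := stub_normSqHessian M g f hg hsol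
  have hD := stub_hessianEnergy_of_identities M g f hg hf hsol hB hH
  refine diffeomorph_sphere_of_varianceBudget hCGY hCGB M e g f hg hf hsol ?_
  linarith [hD, hHess]

/-- **The crux from a bound on the weighted variance of the potential and on its supremum** — for the
crux data with `f ≤ c` and `½ e^{c} ∫ (f − 2)² e^{-f} dV < Vol − 48π²` one has `M ≃ₘ S⁴`:
pointwise `|Hess f|² ≤ e^{c}·|Hess f|² e^{-f}` (`|Hess f|² ≥ 0`, `e^{c − f} ≥ 1`), so
`∫|Hess f|² ≤ e^{c}∫|Hess f|²e^{-f} = ½e^{c}∫|∇f|²e^{-f} = ½e^{c}∫(f − 2)²e^{-f}` (STUBS 10–11), and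
`compactShrinkerGap_of_hessianEnergy_lt` finishes. The weighted variance is an entropy-side quantity
(`= ∫|∇f|²e^{-f}`, the Dirichlet term of Perelman's `𝒲` at the minimiser); the exposure is `sup f`
(cf. the CRZ sub-line: `f ≤ 3.08` is the ceiling there). [cite: ChengRibeiroZhou2022, Thm. 1 and §3.2]
[cite: ChangGurskyYang2003, Thm. A] -/
theorem compactShrinkerGap_of_weightedVariance (hCGY : ChangGurskyYang)
    (hCGB : Literature.Geometry.Riemannian.chernGaussBonnet_four)
    (M : Type) [TopologicalSpace M] [T2Space M] [SecondCountableTopology M]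
    [ChartedSpace (EuclideanSpace ℝ (Fin 4)) M] [IsManifold (𝓡 4) ∞ M] [CompactSpace M]
    [T3Space M] [MeasurableSpace M] [BorelSpace M]
    (e : M ≃ₕ Metric.sphere (0 : EuclideanSpace ℝ (Fin 5)) 1)
    (g : Literature.Geometry.Lorentzian.PseudoRiemannianMetric (𝓡 4) ∞ (EuclideanSpace ℝ (Fin 4))
      (TangentSpace (𝓡 4) : M → Type _)) [g.HasLeviCivita] (f : M → ℝ) (hg : g.IsRiemannian)
    (hf : ContMDiff (𝓡 4) 𝓘(ℝ, ℝ) ∞ f)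
    (hsol : ∀ (x : M) (X Y : TangentSpace (𝓡 4) x),
      g.ricci x X Y + g.hessian f x X Y = (1 / 2 : ℝ) * g.val x X Y)
    (hnorm : ∀ x : M, g.scalarCurvature x + g.gradSq f x = f x)
    (c : ℝ) (hfc : ∀ x : M, f x ≤ c)
    (hvar : Real.exp c / 2 * ∫ x, (f x - 2) ^ 2 * Real.exp (-f x)
          ∂(Literature.Geometry.Lorentzian.riemannianMeasure (g.toContMDiffRiemannianMetric hg)) <
        ((Literature.Geometry.Lorentzian.riemannianMeasure (g.toContMDiffRiemannianMetric hg))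
            Set.univ).toReal - 48 * Real.pi ^ 2) :
    Nonempty (M ≃ₘ⟮𝓡 4, 𝓡 4⟯ (Metric.sphere (0 : EuclideanSpace ℝ (Fin 5)) 1)) := by
  obtain ⟨_, hB⟩ := Theorems.stub_shrinkerScalarIdentities M g f hg hf hsol
  have hH := stub_normSqHessian M g f hg hsol
  have h10 := stub_weightedDirichlet M g f hg hf hsol hnorm
  have h11 := stub_weightedHessianEnergy_of_identities M g f hg hf hsol hnorm hB hH
  -- measures and integrability: every integrand is continuous on the compact manifold
  have hV : g.riemVolume = riemannianMeasure (g.toContMDiffRiemannianMetric hg) :=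
    PseudoRiemannianMetric.riemVolume_eq hg
  have hRc : Continuous g.scalarCurvature := g.contMDiff_scalarCurvature.continuous
  have hQc : Continuous fun x ↦ g.normSq x (g.ricci x) := g.contMDiff_normSq_ricci'.continuous
  have hHc : Continuous fun x ↦ g.normSq x (g.hessian f x) := by
    have : (fun x ↦ g.normSq x (g.hessian f x)) =
        fun x ↦ g.normSq x (g.ricci x) + 1 - g.scalarCurvature x := funext hH
    rw [this]
    exact (hQc.add continuous_const).sub hRc
  have hEc : Continuous fun x ↦ Real.exp (-f x) := Real.continuous_exp.comp hf.continuous.neg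
  have iH : Integrable (fun x ↦ g.normSq x (g.hessian f x))
      (riemannianMeasure (g.toContMDiffRiemannianMetric hg)) := hV ▸ g.integrable_of_continuous hHc
  have iHw : Integrable (fun x ↦ Real.exp c * (g.normSq x (g.hessian f x) * Real.exp (-f x)))
      (riemannianMeasure (g.toContMDiffRiemannianMetric hg)) :=
    hV ▸ g.integrable_of_continuous (continuous_const.mul (hHc.mul hEc))
  -- pointwise `|Hess f|² ≤ e^{c} |Hess f|² e^{-f}`
  have hpt : ∀ x, g.normSq x (g.hessian f x) ≤
      Real.exp c * (g.normSq x (g.hessian f x) * Real.exp (-f x)) := fun x ↦ by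
    have h0 : 0 ≤ g.normSq x (g.hessian f x) := g.normSq_nonneg x hg _
    have h1 : 1 ≤ Real.exp c * Real.exp (-f x) := by
      rw [← Real.exp_add]
      exact Real.one_le_exp (by linarith [hfc x])
    nlinarith
  have hle := integral_mono iH iHw hpt
  rw [integral_const_mul, h11, h10] at hle
  refine compactShrinkerGap_of_hessianEnergy_lt hCGY hCGB M e g f hg hf hsol ?_
  linarith [hle, hvar]

/-- **The crux from a bound on the UNWEIGHTED Dirichlet energy of the potential** — for the crux data,
`∫|∇f|² dV < (2·Vol − 96π²)/3` gives `M ≃ₘ S⁴`: by STUB 12, `D = ∫|∇f|²(3 − R) ≤ 3∫|∇f|²` since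
`R > 0` (landed positivity) and `|∇f|² ≥ 0` (`gradSq_nonneg`), so `D < 2Vol − 96π²` and the finisher
applies. Crude (the sign change of `3 − R` is thrown away) but a genuinely integral condition on `f`
alone (`∫|∇f|² dV = ∫f dV − 2Vol`: the unweighted mean of `f` is `< 8/3 − 32π²/Vol`).
[cite: ChengRibeiroZhou2022, Rem. 2] [cite: ChangGurskyYang2003, Thm. A] -/
theorem compactShrinkerGap_of_dirichletEnergy_lt (hCGY : ChangGurskyYang)
    (hCGB : Literature.Geometry.Riemannian.chernGaussBonnet_four)
    (M : Type) [TopologicalSpace M] [T2Space M] [SecondCountableTopology M]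
    [ChartedSpace (EuclideanSpace ℝ (Fin 4)) M] [IsManifold (𝓡 4) ∞ M] [CompactSpace M]
    [T3Space M] [MeasurableSpace M] [BorelSpace M]
    (e : M ≃ₕ Metric.sphere (0 : EuclideanSpace ℝ (Fin 5)) 1)
    (g : Literature.Geometry.Lorentzian.PseudoRiemannianMetric (𝓡 4) ∞ (EuclideanSpace ℝ (Fin 4))
      (TangentSpace (𝓡 4) : M → Type _)) [g.HasLeviCivita] (f : M → ℝ) (hg : g.IsRiemannian)
    (hf : ContMDiff (𝓡 4) 𝓘(ℝ, ℝ) ∞ f)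
    (hsol : ∀ (x : M) (X Y : TangentSpace (𝓡 4) x),
      g.ricci x X Y + g.hessian f x X Y = (1 / 2 : ℝ) * g.val x X Y)
    (hnorm : ∀ x : M, g.scalarCurvature x + g.gradSq f x = f x)
    (hDir : ∫ x, g.gradSq f x
          ∂(Literature.Geometry.Lorentzian.riemannianMeasure (g.toContMDiffRiemannianMetric hg)) <
        (2 * ((Literature.Geometry.Lorentzian.riemannianMeasure (g.toContMDiffRiemannianMetric hg))
            Set.univ).toReal - 96 * Real.pi ^ 2) / 3) :
    Nonempty (M ≃ₘ⟮𝓡 4, 𝓡 4⟯ (Metric.sphere (0 : EuclideanSpace ℝ (Fin 5)) 1)) := by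
  obtain ⟨_, hB⟩ := Theorems.stub_shrinkerScalarIdentities M g f hg hf hsol
  have hR : ∀ x : M, 0 < g.scalarCurvature x :=
    Theorems.stub_scalarCurvaturePos_of_identities M g f hg hf hsol hB
  have hD := stub_variance_eq_gradSq_mul M g f hg hf hsol hnorm
  -- integrability: continuous integrands on the compact manifold
  have hV : g.riemVolume = riemannianMeasure (g.toContMDiffRiemannianMetric hg) :=
    PseudoRiemannianMetric.riemVolume_eq hg
  have hf1 : ContMDiff (𝓡 4) 𝓘(ℝ, ℝ) 1 f := hf.of_le (by norm_num)
  have hGc : Continuous (g.gradSq f) := continuous_innerDual_mvfderiv g hf1 hf1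
  have hRc : Continuous g.scalarCurvature := g.contMDiff_scalarCurvature.continuous
  have iG : Integrable (fun x ↦ g.gradSq f x * (3 - g.scalarCurvature x))
      (riemannianMeasure (g.toContMDiffRiemannianMetric hg)) :=
    hV ▸ g.integrable_of_continuous (hGc.mul (continuous_const.sub hRc))
  have iG3 : Integrable (fun x ↦ 3 * g.gradSq f x)
      (riemannianMeasure (g.toContMDiffRiemannianMetric hg)) :=
    hV ▸ g.integrable_of_continuous (continuous_const.mul hGc)
  have hpt : ∀ x, g.gradSq f x * (3 - g.scalarCurvature x) ≤ 3 * g.gradSq f x := fun x ↦ by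
    nlinarith [hR x, g.gradSq_nonneg hg f x]
  have hle := integral_mono iG iG3 hpt
  rw [integral_const_mul] at hle
  refine diffeomorph_sphere_of_varianceBudget hCGY hCGB M e g f hg hf hsol ?_
  rw [hD]
  linarith

/-! ## The Cheng–Ribeiro–Zhou route to STUB 1 (alternative composition; v8: CRZ sharp is the COMPOSED theorem
`crzSharpBound`, the only open input is STUB 7 `stub_potentialLeThree`) -/

/-- **Arithmetic core of the CRZ route** (`Z₀ = 32π²√π e^{-3/2} < Z`, Jensen `Z ≤ e^{-2}V`,
CRZ-sharp with `f ≤ 3`: `D ≤ ½(e³Z − V)` ⇒ `D < 2V − 96π²`): `e³Z ≤ eV`, `V > e²Z₀ =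
32π²√π e^{1/2}`, and `(5 − e)√π e^{1/2} > 6` (numerically `6.667`), so
`e³Z + 192π² < eV + (5 − e)V = 5V`. [folklore] -/
theorem varianceBudget_arith {V Z D : ℝ}
    (hZ₀ : 32 * Real.pi ^ 2 * Real.sqrt Real.pi * Real.exp (-(3 : ℝ) / 2) < Z)
    (hJ : Z ≤ Real.exp (-2) * V)
    (hD : D ≤ 1 / 2 * (Real.exp 3 * Z - V)) :
    D < 2 * V - 96 * Real.pi ^ 2 := by
  have hπ := Real.pi_pos
  -- exponential bookkeeping
  have E₁ : Real.exp 2 * Real.exp (-2) = 1 := by rw [← Real.exp_add]; norm_num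
  have E₂ : Real.exp 3 = Real.exp 1 * Real.exp 2 := by rw [← Real.exp_add]; norm_num
  have E₃ : Real.exp (-(3 : ℝ) / 2) * Real.exp 2 = Real.exp (1 / 2) := by
    rw [← Real.exp_add]; norm_num
  -- `e²Z ≤ V`, `e³Z ≤ eV`, `V > 32π²√π e^{1/2}`
  have hV : Real.exp 2 * Z ≤ V := by
    calc Real.exp 2 * Z ≤ Real.exp 2 * (Real.exp (-2) * V) :=
          mul_le_mul_of_nonneg_left hJ (Real.exp_pos 2).le
      _ = V := by rw [← mul_assoc, E₁, one_mul]
  have h3Z : Real.exp 3 * Z ≤ Real.exp 1 * V := by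
    rw [E₂, mul_assoc]
    exact mul_le_mul_of_nonneg_left hV (Real.exp_pos 1).le
  have hV₀ : 32 * Real.pi ^ 2 * Real.sqrt Real.pi * Real.exp (1 / 2) < V := by
    calc 32 * Real.pi ^ 2 * Real.sqrt Real.pi * Real.exp (1 / 2)
        = (32 * Real.pi ^ 2 * Real.sqrt Real.pi * Real.exp (-(3 : ℝ) / 2)) * Real.exp 2 := by
          rw [← E₃]; ring
      _ < Z * Real.exp 2 := mul_lt_mul_of_pos_right hZ₀ (Real.exp_pos 2)
      _ ≤ V := by rw [mul_comm]; exact hV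
  -- numerics: `(5 − e) · √π · e^{1/2} > 6`
  have hs : (1.77245 : ℝ) < Real.sqrt Real.pi := by
    rw [Real.lt_sqrt (by norm_num)]
    have := Real.pi_gt_d6
    nlinarith
  have ht : (1.6487 : ℝ) < Real.exp (1 / 2) := by
    have h : (1.6487 : ℝ) ^ 2 < Real.exp (1 / 2) ^ 2 := by
      rw [← Real.exp_nat_mul]
      norm_num
      have := Real.exp_one_gt_d9
      linarith
    exact lt_of_pow_lt_pow_left₀ 2 (Real.exp_pos _).le h
  have ht' : Real.exp (1 / 2) < (1.6488 : ℝ) := by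
    have h : Real.exp (1 / 2) ^ 2 < (1.6488 : ℝ) ^ 2 := by
      rw [← Real.exp_nat_mul]
      norm_num
      have := Real.exp_one_lt_d9
      linarith
    exact lt_of_pow_lt_pow_left₀ 2 (by norm_num) h
  have he : Real.exp 1 = Real.exp (1 / 2) ^ 2 := by rw [← Real.exp_nat_mul]; norm_num
  have h5 : (2.2814 : ℝ) < 5 - Real.exp 1 := by
    rw [he]
    nlinarith [ht', Real.exp_pos (1 / 2 : ℝ)]
  have h5e : 0 < 5 - Real.exp 1 := by linarith
  have hst : (1.77245 : ℝ) * 1.6487 < Real.sqrt Real.pi * Real.exp (1 / 2) :=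
    mul_lt_mul'' hs ht (by norm_num) (by norm_num)
  have key : (6 : ℝ) < (5 - Real.exp 1) * (Real.sqrt Real.pi * Real.exp (1 / 2)) := by
    calc (6 : ℝ) < 2.2814 * (1.77245 * 1.6487) := by norm_num
      _ < (5 - Real.exp 1) * (Real.sqrt Real.pi * Real.exp (1 / 2)) :=
          mul_lt_mul'' h5 hst (by norm_num) (by norm_num)
  -- `192π² < (5 − e)V`
  have hfin : 192 * Real.pi ^ 2 < 5 * V - Real.exp 1 * V := by
    have hp : 0 < 32 * Real.pi ^ 2 := by positivity
    have h1 : 32 * Real.pi ^ 2 * 6 <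
        32 * Real.pi ^ 2 * ((5 - Real.exp 1) * (Real.sqrt Real.pi * Real.exp (1 / 2))) :=
      mul_lt_mul_of_pos_left key hp
    have h2 : (5 - Real.exp 1) * (32 * Real.pi ^ 2 * Real.sqrt Real.pi * Real.exp (1 / 2)) <
        (5 - Real.exp 1) * V :=
      mul_lt_mul_of_pos_left hV₀ h5e
    have h3 : 32 * Real.pi ^ 2 * ((5 - Real.exp 1) * (Real.sqrt Real.pi * Real.exp (1 / 2))) =
        (5 - Real.exp 1) * (32 * Real.pi ^ 2 * Real.sqrt Real.pi * Real.exp (1 / 2)) := by ring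
    have h4 : (5 - Real.exp 1) * V = 5 * V - Real.exp 1 * V := by ring
    linarith
  linarith [hD, h3Z, hfin]

/-- **The variance budget from a pointwise bound `f ≤ 3` (v8; sorry-free given STUBS 13–15):** for a closed
normalised shrinker of Gaussian mass `> Z₀` with `f ≤ 3` everywhere, `∫(R − 2)² dV < 2·Vol − 96π²` — CRZ sharp at
`c = 3` (`crzSharpBound`), Jensen `Z ≤ e^{-2}V` (landed `Theorems.stub_jensenVolumeBound`) and
`varianceBudget_arith`; the density hypothesis is converted from its `lintegral` form (`e^{-f}` is continuous
on the compact `M`, of finite Riemannian volume `riemannianVolume_lt_top_of_isCompact_holds`). The homotopy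
type of `M` is not used. [cite: ChengRibeiroZhou2022, Thm. 1 and Rem. 2] -/
theorem varianceBudget_of_potential_le_three
    (M : Type) [TopologicalSpace M] [T2Space M] [SecondCountableTopology M]
    [ChartedSpace (EuclideanSpace ℝ (Fin 4)) M] [IsManifold (𝓡 4) ∞ M] [CompactSpace M]
    [T3Space M] [MeasurableSpace M] [BorelSpace M]
    (g : Literature.Geometry.Lorentzian.PseudoRiemannianMetric (𝓡 4) ∞ (EuclideanSpace ℝ (Fin 4))
      (TangentSpace (𝓡 4) : M → Type _)) [g.HasLeviCivita] (f : M → ℝ) (hg : g.IsRiemannian)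
    (hf : ContMDiff (𝓡 4) 𝓘(ℝ, ℝ) ∞ f)
    (hsol : ∀ (x : M) (X Y : TangentSpace (𝓡 4) x),
      g.ricci x X Y + g.hessian f x X Y = (1 / 2 : ℝ) * g.val x X Y)
    (hnorm : ∀ x : M, g.scalarCurvature x + g.gradSq f x = f x)
    (hdens : ENNReal.ofReal (32 * Real.pi ^ 2 * Real.sqrt Real.pi * Real.exp (-(3 : ℝ) / 2)) <
        ∫⁻ x, ENNReal.ofReal (Real.exp (-f x))
          ∂(Literature.Geometry.Lorentzian.riemannianMeasure (g.toContMDiffRiemannianMetric hg)))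
    (hle3 : ∀ x : M, f x ≤ 3) :
    ∫ x, (g.scalarCurvature x - 2) ^ 2
        ∂(Literature.Geometry.Lorentzian.riemannianMeasure (g.toContMDiffRiemannianMetric hg)) <
      2 * ((Literature.Geometry.Lorentzian.riemannianMeasure (g.toContMDiffRiemannianMetric hg))
            Set.univ).toReal - 96 * Real.pi ^ 2 := by
  -- the Riemannian measure of the closed manifold is finite; `e^{-f}` is continuous, so integrable
  haveI : IsFiniteMeasure
      (Literature.Geometry.Lorentzian.riemannianMeasure (g.toContMDiffRiemannianMetric hg)) :=
    ⟨Literature.Geometry.Lorentzian.riemannianVolume_lt_top_of_isCompact_holds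
      (g.toContMDiffRiemannianMetric hg) le_rfl isCompact_univ⟩
  have hc : Continuous fun x ↦ Real.exp (-f x) := Real.continuous_exp.comp hf.continuous.neg
  obtain ⟨C, hC⟩ := isCompact_univ.exists_bound_of_continuousOn hc.continuousOn
  have hint : Integrable (fun x ↦ Real.exp (-f x))
      (Literature.Geometry.Lorentzian.riemannianMeasure (g.toContMDiffRiemannianMetric hg)) :=
    (memLp_top_of_bound hc.aestronglyMeasurable C
      (ae_of_all _ fun x ↦ hC x (mem_univ x))).integrable le_top
  -- Jensen and CRZ-sharp at `c = 3`
  have hJ := Theorems.stub_jensenVolumeBound M g f hg hf hsol hnorm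
  have hD := crzSharpBound M g f hg hf hsol 3 hle3
  -- the density hypothesis as a real (Bochner) integral
  have hdens' := hdens
  rw [← ofReal_integral_eq_lintegral_ofReal hint (ae_of_all _ fun x ↦ (Real.exp_pos _).le),
    ENNReal.ofReal_lt_ofReal_iff'] at hdens'
  exact varianceBudget_arith hdens'.1 hJ hD

/-- **STUB 7 ⇒ STUB 1** (the statement of `stub_varianceBudget` from `stub_potentialLeThree`; v8: the CRZ bound
is no longer a hypothesis). [cite: ChengRibeiroZhou2022, Thm. 1 and Rem. 2] -/
theorem varianceBudget_via_crz :
    ∀ (M : Type) [TopologicalSpace M] [T2Space M] [SecondCountableTopology M]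
      [ChartedSpace (EuclideanSpace ℝ (Fin 4)) M] [IsManifold (𝓡 4) ∞ M] [CompactSpace M]
      [T3Space M] [MeasurableSpace M] [BorelSpace M],
      M ≃ₕ Metric.sphere (0 : EuclideanSpace ℝ (Fin 5)) 1 →
    ∀ (g : Literature.Geometry.Lorentzian.PseudoRiemannianMetric (𝓡 4) ∞ (EuclideanSpace ℝ (Fin 4))
        (TangentSpace (𝓡 4) : M → Type _)) [g.HasLeviCivita] (f : M → ℝ) (hg : g.IsRiemannian),
      ContMDiff (𝓡 4) 𝓘(ℝ, ℝ) ∞ f →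
      (∀ (x : M) (X Y : TangentSpace (𝓡 4) x),
        g.ricci x X Y + g.hessian f x X Y = (1 / 2 : ℝ) * g.val x X Y) →
      (∀ x : M, g.scalarCurvature x + g.gradSq f x = f x) →
      ENNReal.ofReal (32 * Real.pi ^ 2 * Real.sqrt Real.pi * Real.exp (-(3 : ℝ) / 2)) <
        ∫⁻ x, ENNReal.ofReal (Real.exp (-f x))
          ∂(Literature.Geometry.Lorentzian.riemannianMeasure (g.toContMDiffRiemannianMetric hg)) →
      ∫ x, (g.scalarCurvature x - 2) ^ 2
          ∂(Literature.Geometry.Lorentzian.riemannianMeasure (g.toContMDiffRiemannianMetric hg)) <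
        2 * ((Literature.Geometry.Lorentzian.riemannianMeasure (g.toContMDiffRiemannianMetric hg))
              Set.univ).toReal - 96 * Real.pi ^ 2 := by
  intro M _ _ _ _ _ _ _ _ _ e g _ f hg hf hsol hnorm hdens
  exact varianceBudget_of_potential_le_three M g f hg hf hsol hnorm hdens
    (stub_potentialLeThree M e g f hg hf hsol hnorm hdens)

/-- **The crux under the pointwise bound `f ≤ 3`** (v8; sorry-free given STUBS 13–15, conditional on `hCGY` +
the CGB fact `hCGB`): for the crux data with `f ≤ 3` everywhere, `M ≃ₘ S⁴` — the budget from
`varianceBudget_of_potential_le_three`, the diffeomorphism from `diffeomorph_sphere_of_varianceBudget`. The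
companion of `compactShrinkerGap_of_scalarCurvature_le` (`R ≤ 2.48`): here the hypothesis is on `sup f = sup R`
with the constant `3` (ceiling `3.0807`). [cite: ChengRibeiroZhou2022, Thm. 1 and Rem. 2] [cite: ChangGurskyYang2003, Thm. A] -/
theorem compactShrinkerGap_of_potential_le_three (hCGY : ChangGurskyYang)
    (hCGB : Literature.Geometry.Riemannian.chernGaussBonnet_four)
    (M : Type) [TopologicalSpace M] [T2Space M] [SecondCountableTopology M]
    [ChartedSpace (EuclideanSpace ℝ (Fin 4)) M] [IsManifold (𝓡 4) ∞ M] [CompactSpace M]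
    [T3Space M] [MeasurableSpace M] [BorelSpace M]
    (e : M ≃ₕ Metric.sphere (0 : EuclideanSpace ℝ (Fin 5)) 1)
    (g : Literature.Geometry.Lorentzian.PseudoRiemannianMetric (𝓡 4) ∞ (EuclideanSpace ℝ (Fin 4))
      (TangentSpace (𝓡 4) : M → Type _)) [g.HasLeviCivita] (f : M → ℝ) (hg : g.IsRiemannian)
    (hf : ContMDiff (𝓡 4) 𝓘(ℝ, ℝ) ∞ f)
    (hsol : ∀ (x : M) (X Y : TangentSpace (𝓡 4) x),
      g.ricci x X Y + g.hessian f x X Y = (1 / 2 : ℝ) * g.val x X Y)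
    (hnorm : ∀ x : M, g.scalarCurvature x + g.gradSq f x = f x)
    (hdens : ENNReal.ofReal (32 * Real.pi ^ 2 * Real.sqrt Real.pi * Real.exp (-(3 : ℝ) / 2)) <
        ∫⁻ x, ENNReal.ofReal (Real.exp (-f x))
          ∂(Literature.Geometry.Lorentzian.riemannianMeasure (g.toContMDiffRiemannianMetric hg)))
    (hle3 : ∀ x : M, f x ≤ 3) :
    Nonempty (M ≃ₘ⟮𝓡 4, 𝓡 4⟯ (Metric.sphere (0 : EuclideanSpace ℝ (Fin 5)) 1)) :=
  diffeomorph_sphere_of_varianceBudget hCGY hCGB M e g f hg hf hsol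
    (varianceBudget_of_potential_le_three M g f hg hf hsol hnorm hdens hle3)

/-- **`CompactShrinkerGap` along the CRZ sub-line** (v8): the budget from `varianceBudget_via_crz` (STUB 7 +
the composed CRZ bound + the landed Jensen bound), the diffeomorphism from `diffeomorph_sphere_of_varianceBudget`.
Alternative composition of the same line, modulo the registered OPEN stub `stub_potentialLeThree`, the route
crux `hCGY` and the CGB fact `hCGB`. [cite: ChengRibeiroZhou2022, Thm. 1] [cite: ChangGurskyYang2003, Thm. A] -/
theorem CompactShrinkerGap_of_crz (hCGY : ChangGurskyYang)
    (hCGB : Literature.Geometry.Riemannian.chernGaussBonnet_four) : CompactShrinkerGap := by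
  intro M _ _ _ _ _ _ _ _ _ e g _ f hg hf hsol hnorm hdens
  exact diffeomorph_sphere_of_varianceBudget hCGY hCGB M e g f hg hf hsol
    (varianceBudget_via_crz M e g f hg hf hsol hnorm hdens)


end Summit.SmoothPoincare4.SmoothPoincare4.Cruxes.CompactShrinkerGap.CgyVariancePivot

end
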